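import Summits.QuantumAdvantage.QuantumAdvantage.Theorems.CubicForrelationNearExactIsExactBentMinWeightTools
import Summits.QuantumAdvantage.QuantumAdvantage.Theorems.CubicForrelationNearExactIsExactBentValuesAllN

/-!
# Crux `CubicForrelation.NearExactIsExact` (stmt-QuantumAdvantage-14043) — EVERY `n ≡ 2 (mod 4)`, `n ≥ 14`: a cubic BENT function has no cubic
  partner on the minimum-weight line `Φ = 1 − 2^{1−r₀}`

Certificate seat `b2b-cforr-cert` (gen 45).  HONEST FRAMING: a kernel-checked theorem UNIFORM in `n` (standard axioms, no certificates): for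
`n = 2m`, `m = 2b + 7` (`n = 14, 18, 22, 26, …`) and cubic `f, g : 𝔽₂ⁿ → 𝔽₂` with `g` bent, `Φ(f,g) ≠ 1 − 2/2^{b+5}` (`fo_bent_minweight_ne`:
`15/16` at `n = 14` [= `fo_bent_false`, gen 9], `31/32` at `18`, `63/64` at `22`, `127/128` at `26`, … — from `n = 18` on these values lie
INSIDE the open windows `[15/16, 1 − 2^{−⌊n/3⌋−1})` of the `θ_n` ladder).  With `fo_bent_values_all`: the bent side of the slice `n = 4b + 14`
has `Φ ∈ {1, 1 − 3/2^{b+5}} ∪ (−∞, 1 − 7/2^{b+6}]` (`fo_bent_values_two_mod_four`; the `1.5·d` line `1 − 3/2^{b+5}` is dead at `n = 14, 18, 22`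
by gen 44, not uniformly yet).  NOT summit progress: the windows of the `θ_n` ladder are unchanged (non-bent configurations untouched), and the
bound tends to `1`.

Proof (gen 9's mechanism with `b + 5` transversal directions, via the list tools …BentMinWeightTools): `d = g̃` has degree `≤ b + 5` (Hou),
`#{f ≠ d} = 2^{3b+9}`, so `f ⊕ d` is the indicator of a flat `A = q ⊕ V` of codimension `b + 5` (`mw_flat_of_minweight`); with `W_g = 2^{2b+5}·u`,
`u = 4(−1)^d`, the residual `τ = u − 4(−1)^f = 8(−1)^d·1_A` has `(b+7)`-flat sums `≡ 0 (mod 32)` (`fs_flat_sum_dvd`: `(2b+5) + 5 ≤ (b+7) +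
⌈(3b+7)/3⌉` — equality; `sl_sum_sZ_flat`: `2^{⌈(b+7)/3⌉} ≥ 8`); a transversal chain of `b + 5` directions (`kbm_chain_exists`, `2^{3b+9}·2^{b+5}
= 2ⁿ`) localises the flat sum to a 2-flat inside `A` (`kbm_peel_all`), so `d` is affine along `A`; then `D = Ŵ[(−1)^d 1_A]` has
`|D| ∈ {0, 2^{3b+9}}`, `Σ|D| = 2ⁿ`, against `Σ (−1)^g D = 2^{5b+16} > 2^{4b+14}` from bent duality and `Φ(g,f) = Φ(f,g)`.

References: O. S. Rothaus (1976); X.-D. Hou (1998); J. Ax (1964) / R. J. McEliece (1972); MacWilliams–Sloane (1977) Ch. 13 §4; DISPROOF.md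
§18 (THEOREM BENT, there with machine certificates per `n`).  Axioms: the standard three.
-/

set_option linter.dupNamespace false -- D-0017: single-problem summit ⇒ `QuantumAdvantage.QuantumAdvantage` by design

noncomputable section

namespace Summit.QuantumAdvantage.QuantumAdvantage.Theorems.CubicForrelation.NearExactIsExact

open Finset
open Literature.Computability.QuantumComplexity
open Literature.Computability.QuantumComplexity.BuzetChailloux (bxor zeroVec bxor_bxor_cancel_left bxor_zeroVec zeroVec_bxor bxor_comm
  bxor_self)
open Literature.Computability.QuantumComplexity.DerivativeWalsh (W twist_bxor_left)

/-! ### The minimum-weight line of the bent side, every `n = 4b + 14` -/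

/-- **A bent cubic on `n = 4b + 14` bits has no cubic partner at `Φ = 1 − 2/2^{b+5}`.**  For cubic `f, g : 𝔽₂ⁿ → 𝔽₂`, `n = 2m`,
`m = 2b + 7`, with `g` bent (`W_g² ≡ 2ⁿ`) and `Φ(f,g) = 1 − 2/2^{b+5}`: contradiction (the header describes the proof).  Uniform in `n`;
NOT summit progress. [this work] -/
theorem fo_bent_minweight_false (b : ℕ) (f g : (Fin ((2 * b + 7) + (2 * b + 7)) → Bool) → Bool) (hf : IsDegLeFun 3 f)
    (hg : IsDegLeFun 3 g) (hbent : ∀ x, W (fun y => signOf (g y)) x ^ 2 = (2 : ℝ) ^ ((2 * b + 7) + (2 * b + 7)))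
    (hΦ : forrelation f g = 1 - 2 / 2 ^ (b + 5)) : False := by
  classical
  -- the dual and its degree
  obtain ⟨d, hd⟩ := bb_exists_dual hbent
  have hdeg : IsDegLeFun (b + 4 + 1) d := by
    have h := stub_houCubic stub_axParity (2 * b + 7) g d hg hd
    rwa [show (2 * b + 7 + 3) / 2 = b + 4 + 1 by omega] at h
  -- powers of two
  have hn : ((2 : ℝ) ^ ((2 * b + 7) + (2 * b + 7))) = 2 ^ (4 * b + 14) := by ring
  -- distance `2^{3b+9}`
  have hsum := vg_two_pow_mul_forrelation f g
  rw [hΦ, sum_congr rfl fun x _ => by rw [hd x]] at hsum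
  have hsd : ∑ x, signOf (f x) * signOf (d x) = (2 : ℝ) ^ (4 * b + 14) - 2 * 2 ^ (3 * b + 9) := by
    have e : ∑ x, signOf (f x) * ((2 : ℝ) ^ (2 * b + 7) * signOf (d x)) = 2 ^ (2 * b + 7) * ∑ x, signOf (f x) * signOf (d x) := by
      rw [mul_sum]; exact sum_congr rfl fun x _ => by ring
    have c : (2 : ℝ) ^ (3 * (2 * b + 7)) * (1 - 2 / 2 ^ (b + 5)) = 2 ^ (2 * b + 7) * (2 ^ (4 * b + 14) - 2 * 2 ^ (3 * b + 9)) := by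
      rw [show (2 : ℝ) ^ (3 * (2 * b + 7)) = 2 ^ (b + 5) * 2 ^ (5 * b + 16) by ring]
      field_simp
      ring
    rw [e, c] at hsum
    exact (mul_left_cancel₀ (by positivity) hsum).symm
  rw [bb_sum_signOf_mul_signOf, ← bb_filter_bxor_eq, hn] at hsd
  have hcard : #(univ.filter fun x : Fin ((2 * b + 7) + (2 * b + 7)) → Bool => (f x ^^ d x) = true) = 2 ^ (3 * b + 9) := by
    have h : (#(univ.filter fun x : Fin ((2 * b + 7) + (2 * b + 7)) → Bool => (f x ^^ d x) = true) : ℝ) = 2 ^ (3 * b + 9) := by linarith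
    exact_mod_cast h
  -- the word `f ⊕ d` is a minimum-weight word of `RM(b+5, n)`: a flat `A` of codimension `b + 5`
  have he : IsDegLeFun (b + 4 + 1) (fun x => f x ^^ d x) := bb_isDegLeFun_bxor (hf.mono (by omega)) hdeg
  obtain ⟨h0, hadd, hcardV, hcoset⟩ := mw_flat_of_minweight (b + 4) (fun x => f x ^^ d x) he (by rw [hcard]; ring)
  set V := univ.filter (fun a : Fin ((2 * b + 7) + (2 * b + 7)) → Bool => ∀ x, (f (bxor x a) ^^ d (bxor x a)) = (f x ^^ d x)) with hVdef
  rw [hcard] at hcardV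
  have hApos : 0 < #(univ.filter fun x : Fin ((2 * b + 7) + (2 * b + 7)) → Bool => (f x ^^ d x) = true) := by rw [hcard]; positivity
  obtain ⟨x₀, hx₀⟩ := card_pos.1 hApos
  have hx₀' : (f x₀ ^^ d x₀) = true := (mem_filter.1 hx₀).2
  set A := univ.filter (fun x : Fin ((2 * b + 7) + (2 * b + 7)) → Bool => (f x ^^ d x) = true) with hAdef
  have hS : A = V.image (bxor x₀) := hcoset x₀ hx₀'
  have hmemA : ∀ x, x ∈ A ↔ (f x ^^ d x) = true := fun x => by simp [hAdef]
  have hAV : ∀ x, x ∈ A → ∀ a ∈ V, bxor x a ∈ A := fun x hx a ha => fl1_coset_vadd hadd hS hx ha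
  -- the `g`-side residual in the `f`-domain: `u − 4s = 8(−1)^d·1_A` (`W_g = 2^{2b+5}·u`, `u = 4(−1)^d`)
  set u : (Fin ((2 * b + 7) + (2 * b + 7)) → Bool) → ℤ := fun x => 4 * sZ (d x) with hudef
  have hu : ∀ x, W (fun y => signOf (g y)) x = (2 : ℝ) ^ (2 * b + 5) * (u x : ℝ) := by
    intro x; rw [hd x]; simp only [u]; push_cast; rw [tp_sZ_cast]; ring
  set τ : (Fin ((2 * b + 7) + (2 * b + 7)) → Bool) → ℤ := fun x => u x - 4 * sZ (f x) with hτdef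
  have hτA : ∀ x, x ∈ A → τ x = 8 * sZ (d x) := by
    intro x hx
    have h := (hmemA x).1 hx
    simp only [τ, u]
    have : f x = !d x := by revert h; cases f x <;> cases d x <;> decide
    rw [this]; cases d x <;> simp [sZ]
  have hτ0 : ∀ x, x ∉ A → τ x = 0 := by
    intro x hx
    have h : ¬ (f x ^^ d x) = true := fun h' => hx ((hmemA x).2 h')
    simp only [τ, u]
    have : f x = d x := by revert h; cases f x <;> cases d x <;> decide
    rw [this]; ring
  -- general `(b+7)`-flat sums of `τ` are `≡ 0 (mod 32)` (any parametrisation)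
  have h32 : ∀ {K : ℕ}, K = b + 7 → ∀ (q : Fin ((2 * b + 7) + (2 * b + 7)) → Bool) (a : Fin K → Fin ((2 * b + 7) + (2 * b + 7)) → Bool),
      (32 : ℤ) ∣ ∑ ε : Fin K → Bool, τ (fun j => q j ^^ decide (Odd #(univ.filter fun i => ε i && a i j))) := by
    intro K hK q a
    subst hK
    have h1 := fs_flat_sum_dvd (e := 5) g u hg hu q a (by omega)
    obtain ⟨zf, hzf⟩ := sl_sum_sZ_flat f hf q a
    have hp : (2 : ℤ) ^ ((b + 7 + 2) / 3) = 8 * 2 ^ (b / 3) := by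
      rw [show (b + 7 + 2) / 3 = b / 3 + 3 by omega, pow_add]; ring
    have h2 : ∑ ε : Fin (b + 7) → Bool, τ (fun j => q j ^^ decide (Odd #(univ.filter fun i => ε i && a i j))) =
        ∑ ε : Fin (b + 7) → Bool, u (fun j => q j ^^ decide (Odd #(univ.filter fun i => ε i && a i j))) -
        4 * ∑ ε : Fin (b + 7) → Bool, sZ (f (fun j => q j ^^ decide (Odd #(univ.filter fun i => ε i && a i j)))) := by
      simp only [τ]; rw [sum_sub_distrib, mul_sum]
    rw [h2, hzf, hp]
    norm_num at h1 ⊢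
    exact dvd_sub h1 (Dvd.intro (2 ^ (b / 3) * zf) (by ring))
  -- a transversal chain of `b + 5` directions
  obtain ⟨ts, -, hlen, -, -, -, -, -, hchain⟩ := kbm_chain_exists V h0 hadd (b + 5) (by
    rw [hcardV]; exact le_of_eq (by ring))
  -- (H2): 2-flat sign sums of `d` inside `A` are `≡ 0 (mod 4)`
  have H2 : ∀ q, q ∈ A → ∀ a c : Fin ((2 * b + 7) + (2 * b + 7)) → Bool, a ∈ V → c ∈ V →
      sZ (d (bxor (bxor q c) a)) * sZ (d q) = sZ (d (bxor q c)) * sZ (d (bxor q a)) := by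
    intro q hq a c ha hc
    have hSq : A = V.image (bxor q) := hcoset q ((hmemA q).1 hq)
    -- the big flat `q ⊕ ⟨ts, a, c⟩`
    set l := ts ++ [a, c] with hl
    have hlK : l.length = b + 7 := by simp [hl, hlen]
    have h7 := h32 hlK q (fun i => l[(i : ℕ)])
    rw [kbm_sum_flat_list l.length τ q (fun i => l[(i : ℕ)]), List.ofFn_getElem] at h7
    rw [kbm_peel_all V q τ (fun x hx => hτ0 x (by rw [hSq]; exact hx)) [a, c]
      (fun r hr => by simp only [List.mem_cons, List.not_mem_nil, or_false] at hr; rcases hr with rfl | rfl <;> assumption)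
      ts hchain] at h7
    simp only [List.foldr_cons, List.foldr_nil, List.map_cons, List.map_nil, List.cons_append, List.nil_append, List.sum_cons,
      List.sum_nil, add_zero] at h7
    have hqc : bxor q c ∈ A := hAV q hq c hc
    have hqa : bxor q a ∈ A := hAV q hq a ha
    have hqca : bxor (bxor q c) a ∈ A := hAV _ hqc a ha
    rw [hτA q hq, hτA _ hqc, hτA _ hqa, hτA _ hqca] at h7
    have h4 : (4 : ℤ) ∣ sZ (d q) + sZ (d (bxor q c)) + sZ (d (bxor q a)) + sZ (d (bxor (bxor q c) a)) := by
      have e : (8 * sZ (d q) + (8 * sZ (d (bxor q c)) + (8 * sZ (d (bxor q a)) + 8 * sZ (d (bxor (bxor q c) a)))) : ℤ) =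
          8 * (sZ (d q) + sZ (d (bxor q c)) + sZ (d (bxor q a)) + sZ (d (bxor (bxor q c) a))) := by ring
      rw [e, show (32 : ℤ) = 8 * 4 by norm_num] at h7
      exact (mul_dvd_mul_iff_left (by norm_num : (8 : ℤ) ≠ 0)).1 h7
    exact fl_signs_of_four_dvd (tp_sZ_cases _) (tp_sZ_cases _) (tp_sZ_cases _) (tp_sZ_cases _) h4
  -- the multiplicative character on `V` and the values of `D`
  set D : (Fin ((2 * b + 7) + (2 * b + 7)) → Bool) → ℝ := W (fun x => if x ∈ A then signOf (d x) else 0) with hDdef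
  have hDval : ∀ y, D y = 0 ∨ D y = 2 ^ (3 * b + 9) * (signOf (d x₀) * twist x₀ y) ∨
      D y = -(2 ^ (3 * b + 9) * (signOf (d x₀) * twist x₀ y)) := by
    intro y
    set ρ : (Fin ((2 * b + 7) + (2 * b + 7)) → Bool) → ℝ := fun v => signOf (d (bxor x₀ v)) * signOf (d x₀) * twist v y with hρ
    have hρ1 : ∀ v ∈ V, ρ v = 1 ∨ ρ v = -1 := by
      intro v _
      simp only [ρ]
      rcases Simon.twist_eq_one_or v y with h | h <;> rw [h] <;> unfold signOf <;> split_ifs <;> norm_num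
    have hρmul : ∀ v ∈ V, ∀ w ∈ V, ρ (bxor v w) = ρ v * ρ w := by
      intro v hv w hw
      simp only [ρ]
      have hx₀A : x₀ ∈ A := hx₀
      have key := H2 x₀ hx₀A w v hw hv
      have key' : signOf (d (bxor (bxor x₀ v) w)) * signOf (d x₀) = signOf (d (bxor x₀ v)) * signOf (d (bxor x₀ w)) := by
        have := congrArg (fun z : ℤ => (z : ℝ)) key
        push_cast at this
        rw [tp_sZ_cast, tp_sZ_cast, tp_sZ_cast, tp_sZ_cast] at this
        exact this
      rw [← iw_bxor_assoc, twist_bxor_left]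
      have hs : signOf (d x₀) * signOf (d x₀) = 1 := by unfold signOf; split_ifs <;> norm_num
      calc signOf (d (bxor (bxor x₀ v) w)) * signOf (d x₀) * (twist v y * twist w y)
          = (signOf (d (bxor x₀ v)) * signOf (d (bxor x₀ w))) * (twist v y * twist w y) := by rw [key']
        _ = (signOf (d (bxor x₀ v)) * signOf (d (bxor x₀ w))) * (signOf (d x₀) * signOf (d x₀)) * (twist v y * twist w y) := by
            rw [hs, mul_one]
        _ = signOf (d (bxor x₀ v)) * signOf (d x₀) * twist v y * (signOf (d (bxor x₀ w)) * signOf (d x₀) * twist w y) := by ring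
    have hsumρ := fo_sum_mult_char V hadd ρ hρ1 hρmul
    have hDρ : D y = signOf (d x₀) * twist x₀ y * ∑ v ∈ V, ρ v := by
      simp only [D]
      unfold W
      rw [← sum_filter_add_sum_filter_not univ (fun x => x ∈ A)]
      have hz : ∑ x ∈ univ.filter (fun x => ¬ x ∈ A), (if x ∈ A then signOf (d x) else 0) * twist x y = 0 :=
        sum_eq_zero fun x hx => by rw [if_neg (mem_filter.1 hx).2, zero_mul]
      rw [hz, add_zero, show univ.filter (fun x => x ∈ A) = A from filter_mem_eq_inter.trans (univ_inter A), hS,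
        sum_image fun v _ w _ h => by simpa only [bxor_bxor_cancel_left] using congrArg (bxor x₀) h, mul_sum]
      refine sum_congr rfl fun v hv => ?_
      beta_reduce
      rw [if_pos (mem_image.2 ⟨v, hv, rfl⟩), twist_bxor_left]
      simp only [ρ]
      have hs : signOf (d x₀) * signOf (d x₀) = 1 := by unfold signOf; split_ifs <;> norm_num
      calc signOf (d (bxor x₀ v)) * (twist x₀ y * twist v y)
          = signOf (d (bxor x₀ v)) * (signOf (d x₀) * signOf (d x₀)) * (twist x₀ y * twist v y) := by rw [hs, mul_one]
        _ = signOf (d x₀) * twist x₀ y * (signOf (d (bxor x₀ v)) * signOf (d x₀) * twist v y) := by ring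
    rcases hsumρ with h | h
    · left; rw [hDρ, h, mul_zero]
    · right; left; rw [hDρ, h, hcardV]; push_cast; ring
  have hR : (0 : ℝ) < 2 ^ (3 * b + 9) := by positivity
  have hDabs : ∀ y, |D y| = D y ^ 2 / 2 ^ (3 * b + 9) := by
    intro y
    have hc : |signOf (d x₀) * twist x₀ y| = 1 := by
      rcases Simon.twist_eq_one_or x₀ y with h | h <;> rw [h] <;> unfold signOf <;> split_ifs <;> norm_num
    have hc2 : (signOf (d x₀) * twist x₀ y) ^ 2 = 1 := by
      rcases Simon.twist_eq_one_or x₀ y with h | h <;> rw [h] <;> unfold signOf <;> split_ifs <;> norm_num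
    rcases hDval y with h | h | h
    · rw [h]; simp
    · rw [h, abs_mul, hc, mul_pow, hc2, abs_of_pos hR]; field_simp
    · rw [h, abs_neg, abs_mul, hc, neg_sq, mul_pow, hc2, abs_of_pos hR]; field_simp
  -- Parseval: `Σ |D| = 2ⁿ`
  have hPars := fp_parseval_pm (fun x => if x ∈ A then signOf (d x) else 0) A
    (fun x hx => by rw [if_pos hx]; unfold signOf; split_ifs <;> simp) (fun x hx => by rw [if_neg hx])
  rw [hcard, hn] at hPars
  push_cast at hPars
  have hL1 : ∑ y, |D y| = (2 : ℝ) ^ (4 * b + 14) := by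
    rw [sum_congr rfl fun y _ => hDabs y, ← sum_div]
    simp only [D] at hPars ⊢
    rw [hPars]; field_simp
  -- bent duality `W_d = 2^m·(−1)^g` and the decomposition `W_f = W_d − 2D`
  have hWd : ∀ y, W (fun x => signOf (d x)) y = (2 : ℝ) ^ (2 * b + 7) * signOf (g y) := by
    intro y
    have hinv := tz_inversion (fun y => signOf (g y)) y
    rw [sum_congr rfl fun x _ => by rw [hd x]] at hinv
    have e : ∑ x, (2 : ℝ) ^ (2 * b + 7) * signOf (d x) * twist x y = 2 ^ (2 * b + 7) * W (fun x => signOf (d x)) y := by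
      unfold W; rw [mul_sum]; exact sum_congr rfl fun x _ => by ring
    rw [e, show (2 : ℝ) ^ ((2 * b + 7) + (2 * b + 7)) = 2 ^ (2 * b + 7) * 2 ^ (2 * b + 7) by ring, mul_assoc] at hinv
    exact mul_left_cancel₀ (by positivity) hinv
  have hWf : ∀ y, W (fun x => signOf (f x)) y = (2 : ℝ) ^ (2 * b + 7) * signOf (g y) - 2 * D y := by
    intro y
    have e : (fun x => signOf (f x)) = fun x => signOf (d x) + (-2) * (if x ∈ A then signOf (d x) else 0) := by
      funext x
      by_cases hx : x ∈ A
      · rw [if_pos hx]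
        have h := (hmemA x).1 hx
        have : f x = !d x := by revert h; cases f x <;> cases d x <;> decide
        rw [this]; cases d x <;> simp [signOf] <;> norm_num
      · rw [if_neg hx]
        have h : ¬ (f x ^^ d x) = true := fun h' => hx ((hmemA x).2 h')
        have : f x = d x := by revert h; cases f x <;> cases d x <;> decide
        rw [this]; ring
    rw [e, sp_W_add, fl1_W_smul, hWd]
    simp only [D]; ring
  -- the pairing on the `g`-side: `Σ_y (−1)^{g(y)} D(y) = 2^{5b+16}`
  have hpair := vg_two_pow_mul_forrelation g f
  rw [Summit.QuantumAdvantage.QuantumAdvantage.Theorems.SignedCubicForrelationNotPrBPP.Negative.HalfQuad.forrelation_comm, hΦ,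
    sum_congr rfl fun y _ => by rw [hWf y]] at hpair
  have hsq : ∀ y, signOf (g y) * ((2 : ℝ) ^ (2 * b + 7) * signOf (g y) - 2 * D y) = 2 ^ (2 * b + 7) - 2 * (signOf (g y) * D y) := by
    intro y
    have : signOf (g y) * signOf (g y) = 1 := by unfold signOf; split_ifs <;> norm_num
    linear_combination (2 : ℝ) ^ (2 * b + 7) * this
  rw [sum_congr rfl fun y _ => hsq y, sum_sub_distrib, ← mul_sum, sum_const, card_univ, Fintype.card_fun, Fintype.card_bool,
    Fintype.card_fin, nsmul_eq_mul] at hpair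
  push_cast at hpair
  have c1 : (2 : ℝ) ^ (3 * (2 * b + 7)) * (1 - 2 / 2 ^ (b + 5)) = 2 ^ (3 * (2 * b + 7)) - 2 * 2 ^ (5 * b + 16) := by
    rw [show (2 : ℝ) ^ (3 * (2 * b + 7)) = 2 ^ (b + 5) * 2 ^ (5 * b + 16) by ring]
    field_simp
  have c2 : (2 : ℝ) ^ ((2 * b + 7) + (2 * b + 7)) * 2 ^ (2 * b + 7) = 2 ^ (3 * (2 * b + 7)) := by ring
  rw [c1, c2] at hpair
  have hSD : ∑ y, signOf (g y) * D y = (2 : ℝ) ^ (5 * b + 16) := by linarith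
  have hle : ∑ y, signOf (g y) * D y ≤ ∑ y, |D y| := fl1_pairing_le_l1 g D
  rw [hSD, hL1] at hle
  have hlt : (2 : ℝ) ^ (4 * b + 14) < 2 ^ (5 * b + 16) := pow_lt_pow_right₀ (by norm_num) (by omega)
  linarith

/-- **The minimum-weight line of the bent side is dead, every `n ≡ 2 (mod 4)`, `n ≥ 14`.**  For cubic `f, g : 𝔽₂ⁿ → 𝔽₂`, `n = 2(2b+7)`, with
`g` bent: `Φ(f,g) ≠ 1 − 2/2^{b+5}` (`15/16, 31/32, 63/64, 127/128, …` at `n = 14, 18, 22, 26, …`).  NOT summit progress. [this work] -/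
theorem fo_bent_minweight_ne (b : ℕ) (f g : (Fin ((2 * b + 7) + (2 * b + 7)) → Bool) → Bool) (hf : IsDegLeFun 3 f) (hg : IsDegLeFun 3 g)
    (hbent : ∀ x, W (fun y => signOf (g y)) x ^ 2 = (2 : ℝ) ^ ((2 * b + 7) + (2 * b + 7))) :
    forrelation f g ≠ 1 - 2 / 2 ^ (b + 5) :=
  fun h => fo_bent_minweight_false b f g hf hg hbent h

/-- **The bent side, every `n ≡ 2 (mod 4)`, `n ≥ 14`: values.**  For cubic `f, g : 𝔽₂ⁿ → 𝔽₂`, `n = 2(2b+7)`, with `g` bent: `Φ(f,g) = 1`, or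
`Φ(f,g) = 1 − 3/2^{b+5}` (Kasami–Tokura `1.5·d` line; dead at `n = 14, 18, 22` by gen 44), or `Φ(f,g) ≤ 1 − 7/2^{b+6}`
(`fo_bent_values_all` minus the minimum-weight line).  NOT summit progress. [this work] -/
theorem fo_bent_values_two_mod_four (b : ℕ) (f g : (Fin ((2 * b + 7) + (2 * b + 7)) → Bool) → Bool) (hf : IsDegLeFun 3 f)
    (hg : IsDegLeFun 3 g) (hbent : ∀ x, W (fun y => signOf (g y)) x ^ 2 = (2 : ℝ) ^ ((2 * b + 7) + (2 * b + 7))) :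
    forrelation f g = 1 ∨ forrelation f g = 1 - 3 / 2 ^ (b + 5) ∨ forrelation f g ≤ 1 - 7 / 2 ^ (b + 5 + 1) := by
  have h := fo_bent_values_all (2 * b + 7) (by omega) f g hf hg hbent
  rw [show (2 * b + 7 + 3) / 2 = b + 5 by omega] at h
  rcases h with h | h | h | h
  · exact Or.inl h
  · exact (fo_bent_minweight_ne b f g hf hg hbent h).elim
  · exact Or.inr (Or.inl h)
  · exact Or.inr (Or.inr h)

end Summit.QuantumAdvantage.QuantumAdvantage.Theorems.CubicForrelation.NearExactIsExact

end
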